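import Summits.BirchSwinnertonDyer.Rank1Residual.Supersingular.LocalOddTorsionAdicCompletionAt
import HarnessLib

/-!
# N5 (X7 ∧ r_an = 0) VISIBILITY offers — the free kind-(ii) numerals `#E(ℚ_v)[5] ≤ 5` of the TARGETS at their split multiplicative places `v ≡ 1 (mod 5)`, KERNEL (x10b gen 23)

HONEST FRAMING (cell `b2b-bsdres`, run/shared/lean/b2b/bsd-rank1-residual/, verbatim in every file): the goal of the
cell is to DELETE the COMBINATION-SHAPED residual classes of the Birch–Swinnerton-Dyer formula for ALL analytic-rank `≤ 1`
elliptic curves over `ℚ` — "full BSD formula for every rank `≤ 1` curve in class `C`" assembled STRICTLY from published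
theorems — so that the rank-`≤ 1` remainder becomes exactly the CONSTRUCTION-SHAPED classes, which are TYPED (missing-input
`Prop`s), NOT attempted.  This is not "finishing BSD".
Cell `b2b-bsdres`, supersingular family, prover A = unit `b2b-bsdres-x10b` (gen 23).  Topic file; namespace
`Summit.BirchSwinnertonDyer.Rank1Residual.Supersingular`.  THEOREMS ONLY; no named fact, no definition, nothing booked; X7 stays
CONSTRUCTION-SHAPED; no mark / label / count moved.

## What

Five rank-0 X7 VISIBILITY offers (`bsdp_x7r0vis5_324032u1_5`, `…396998c1_5`, `…346038bt1_5`, `…483238k1_5`, `…448704ce1_5` and their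
`_of_congr` forms; `Supersingular/X7Visibility5Records08/09/11/13/15`) display at a place `v` where BOTH curves are split multiplicative and
`v ≡ 1 (mod 5)` (so `μ₅ ⊂ ℚ_v` and the Weil-pairing bound of `LocalThreeTorsionBoundOfMu` cannot apply) the free kind-(ii) numeral
`∀ w, (primesEquiv w : ℕ) = ℓ → Nat.card (nsmulAddMonoidHom 5 : (W.baseChange (w.adicCompletion ℚ)).toAffine.Point →+ _).ker ≤ 5`
for the TARGET `W` (`ℓ = 61, 4051, 11, 4931, 41`; so far two-engine EVIDENCE, gen 16).  Each theorem below is LITERALLY that binder: the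
kernel decider `LocalOddTorsion.fiveTorsionCheckAt` (`Supersingular/LocalOddTorsionDeciderAt.lean`) finds EXACTLY two roots of `ψ₅` in `ℤ_ℓ`
with a square `g` (`S = 2`, i.e. `#E(ℚ_ℓ)[5] = 5` on the nose: the Tate period is a fifth power times a unit of order prime to 5 — read, not
assumed), `natCard_ker_nsmul_five_adicCompletion_le_five_of_checkAt`; certificates `certs/kind2_certs.json` (x10b gen 23 `code/oddtors_cert.py`),
checked by `decide +kernel` (the child sieve of `RootCensusSieve.check₃` keeps `ℓ = 4051, 4931` at one or two levels).
Usage in a twin: `(h4051 := natCard_ker_five_target_396998c1_at4051_le hWeq)`.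

References: [SilvermanAEC2009] VII.3.1, Ex. 3.7, C.14; [Serre1973] II §3.3; [CremonaMazur2000] §3; [Cremona2006] (labels, models).
-/

set_option autoImplicit false

noncomputable section

open scoped Classical NumberField
open IsDedekindDomain NumberField WeierstrassCurve Rat.HeightOneSpectrum
open Summit.BirchSwinnertonDyer.Rank1Residual.Supersingular.LocalOddTorsion

namespace Summit.BirchSwinnertonDyer.Rank1Residual.Supersingular

/-- **`#ker([5] : E(ℚ_w)) ≤ 5` at the place of `61`** for the X7 TARGET `W = ⟨0, 0, 0, -2140, -38104⟩` = `324032u1` (free kind (ii): both curves split multiplicative, `61 ≡ 1 (mod 5)`; the binder `h61` of `bsdp_x7r0vis5_324032u1_5`, `bsdp_x7r0vis5_324032u1_5_of_congr`): KERNEL — `fiveTorsionCheckAt` at precision `k = 1` with certificate `[((15 : ℤ), 0, 1, 0), ((44 : ℤ), 0, 1, 0)]` finds exactly two roots of `ψ₅` in `ℤ_61`, both with a square `g` (`S = 2`, `#E(ℚ_61)[5] = 5`), checked by `decide +kernel`.  A TOOL-backed discharge of a displayed local binder; per pair; nothing booked. [cite: SilvermanAEC2009, VII.3.1 and Exercise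 3.7] [cite: CremonaMazur2000, §3] [cite: Cremona2006, Table 1 (Cremona label 324032u1)] -/
theorem natCard_ker_five_target_324032u1_at61_le {W : WeierstrassCurve ℚ} (hWeq : W = ⟨0, 0, 0, -2140, -38104⟩) :
    ∀ w : HeightOneSpectrum (𝓞 ℚ), (primesEquiv w : ℕ) = 61 →
      Nat.card (nsmulAddMonoidHom 5 : (W.baseChange (w.adicCompletion ℚ)).toAffine.Point →+ _).ker ≤ 5 := by
  intro w hw
  haveI : Fact (Nat.Prime 61) := ⟨by norm_num⟩
  refine natCard_ker_nsmul_five_adicCompletion_le_five_of_checkAt 61 0 0 0 (-2140) (-38104) (by decide +kernel)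
    (k := 1) (S := 2) (cert := [((15 : ℤ), 0, 1, 0), ((44 : ℤ), 0, 1, 0)]) (by decide +kernel) (by norm_num) W ?_ hw
  rw [hWeq]; ext <;> norm_num

/-- **`#ker([5] : E(ℚ_w)) ≤ 5` at the place of `4051`** for the X7 TARGET `W = ⟨1, 0, 1, -2170726, -1231894058⟩` = `396998c1` (free kind (ii): both curves split multiplicative, `4051 ≡ 1 (mod 5)`; the binder `h4051` of `bsdp_x7r0vis5_396998c1_5`, `bsdp_x7r0vis5_396998c1_5_of_congr`): KERNEL — `fiveTorsionCheckAt` at precision `k = 2` with certificate `[((585 : ℤ), 0, 1, 0), ((2251 : ℤ), 0, 1, 0)]` finds exactly two roots of `ψ₅` in `ℤ_4051`, both with a square `g` (`S = 2`, `#E(ℚ_4051)[5] = 5`), checked by `decide +kernel`.  A TOOL-backed discharge of a displayed local binder; per pair; nothing booked. [cite: SilvermanAEC2009, VII.3.1 and Exercise 3.7] [cite: CremonaMazur2000, §3] [cite: Cremona2006, Table 1 (Cremona label 396998c1)] -/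
theorem natCard_ker_five_target_396998c1_at4051_le {W : WeierstrassCurve ℚ} (hWeq : W = ⟨1, 0, 1, -2170726, -1231894058⟩) :
    ∀ w : HeightOneSpectrum (𝓞 ℚ), (primesEquiv w : ℕ) = 4051 →
      Nat.card (nsmulAddMonoidHom 5 : (W.baseChange (w.adicCompletion ℚ)).toAffine.Point →+ _).ker ≤ 5 := by
  intro w hw
  haveI : Fact (Nat.Prime 4051) := ⟨by norm_num⟩
  refine natCard_ker_nsmul_five_adicCompletion_le_five_of_checkAt 4051 1 0 1 (-2170726) (-1231894058) (by decide +kernel)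
    (k := 2) (S := 2) (cert := [((585 : ℤ), 0, 1, 0), ((2251 : ℤ), 0, 1, 0)]) (by decide +kernel) (by norm_num) W ?_ hw
  rw [hWeq]; ext <;> norm_num

/-- **`#ker([5] : E(ℚ_w)) ≤ 5` at the place of `11`** for the X7 TARGET `W = ⟨1, 1, 1, -17528918, -28210492465⟩` = `346038bt1` (free kind (ii): both curves split multiplicative, `11 ≡ 1 (mod 5)`; the binder `h11` of `bsdp_x7r0vis5_346038bt1_5`, `bsdp_x7r0vis5_346038bt1_5_of_congr`): KERNEL — `fiveTorsionCheckAt` at precision `k = 1` with certificate `[((5 : ℤ), 0, 1, 0), ((8 : ℤ), 0, 1, 0)]` finds exactly two roots of `ψ₅` in `ℤ_11`, both with a square `g` (`S = 2`, `#E(ℚ_11)[5] = 5`), checked by `decide +kernel`.  A TOOL-backed discharge of a displayed local binder; per pair; nothing booked. [cite: SilvermanAEC2009, VII.3.1 and Exercise 3.7] [cite: CremonaMazur2000, §3] [cite: Cremona2006, Table 1 (Cremona label 346038bt1)] -/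
theorem natCard_ker_five_target_346038bt1_at11_le {W : WeierstrassCurve ℚ} (hWeq : W = ⟨1, 1, 1, -17528918, -28210492465⟩) :
    ∀ w : HeightOneSpectrum (𝓞 ℚ), (primesEquiv w : ℕ) = 11 →
      Nat.card (nsmulAddMonoidHom 5 : (W.baseChange (w.adicCompletion ℚ)).toAffine.Point →+ _).ker ≤ 5 := by
  intro w hw
  haveI : Fact (Nat.Prime 11) := ⟨by norm_num⟩
  refine natCard_ker_nsmul_five_adicCompletion_le_five_of_checkAt 11 1 1 1 (-17528918) (-28210492465) (by decide +kernel)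
    (k := 1) (S := 2) (cert := [((5 : ℤ), 0, 1, 0), ((8 : ℤ), 0, 1, 0)]) (by decide +kernel) (by norm_num) W ?_ hw
  rw [hWeq]; ext <;> norm_num

/-- **`#ker([5] : E(ℚ_w)) ≤ 5` at the place of `4931`** for the X7 TARGET `W = ⟨1, 1, 1, -103293, -12821047⟩` = `483238k1` (free kind (ii): both curves split multiplicative, `4931 ≡ 1 (mod 5)`; the binder `h4931` of `bsdp_x7r0vis5_483238k1_5`, `bsdp_x7r0vis5_483238k1_5_of_congr`): KERNEL — `fiveTorsionCheckAt` at precision `k = 1` with certificate `[((1683 : ℤ), 0, 1, 0), ((4267 : ℤ), 0, 1, 0)]` finds exactly two roots of `ψ₅` in `ℤ_4931`, both with a square `g` (`S = 2`, `#E(ℚ_4931)[5] = 5`), checked by `decide +kernel`.  A TOOL-backed discharge of a displayed local binder; per pair; nothing booked. [cite: SilvermanAEC2009, VII.3.1 and Exercise 3.7] [cite: CremonaMazur2000, §3] [cite: Cremona2006, Table 1 (Cremona label 483238k1)] -/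
theorem natCard_ker_five_target_483238k1_at4931_le {W : WeierstrassCurve ℚ} (hWeq : W = ⟨1, 1, 1, -103293, -12821047⟩) :
    ∀ w : HeightOneSpectrum (𝓞 ℚ), (primesEquiv w : ℕ) = 4931 →
      Nat.card (nsmulAddMonoidHom 5 : (W.baseChange (w.adicCompletion ℚ)).toAffine.Point →+ _).ker ≤ 5 := by
  intro w hw
  haveI : Fact (Nat.Prime 4931) := ⟨by norm_num⟩
  refine natCard_ker_nsmul_five_adicCompletion_le_five_of_checkAt 4931 1 1 1 (-103293) (-12821047) (by decide +kernel)
    (k := 1) (S := 2) (cert := [((1683 : ℤ), 0, 1, 0), ((4267 : ℤ), 0, 1, 0)]) (by decide +kernel) (by norm_num) W ?_ hw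
  rw [hWeq]; ext <;> norm_num

/-- **`#ker([5] : E(ℚ_w)) ≤ 5` at the place of `41`** for the X7 TARGET `W = ⟨0, 0, 0, -7543864020, -252196404634784⟩` = `448704ce1` (free kind (ii): both curves split multiplicative, `41 ≡ 1 (mod 5)`; the binder `h41` of `bsdp_x7r0vis5_448704ce1_5`, `bsdp_x7r0vis5_448704ce1_5_of_congr`): KERNEL — `fiveTorsionCheckAt` at precision `k = 1` with certificate `[((6 : ℤ), 0, 1, 0), ((20 : ℤ), 0, 1, 0)]` finds exactly two roots of `ψ₅` in `ℤ_41`, both with a square `g` (`S = 2`, `#E(ℚ_41)[5] = 5`), checked by `decide +kernel`.  A TOOL-backed discharge of a displayed local binder; per pair; nothing booked. [cite: SilvermanAEC2009, VII.3.1 and Exercise 3.7] [cite: CremonaMazur2000, §3] [cite: Cremona2006, Table 1 (Cremona label 448704ce1)] -/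
theorem natCard_ker_five_target_448704ce1_at41_le {W : WeierstrassCurve ℚ} (hWeq : W = ⟨0, 0, 0, -7543864020, -252196404634784⟩) :
    ∀ w : HeightOneSpectrum (𝓞 ℚ), (primesEquiv w : ℕ) = 41 →
      Nat.card (nsmulAddMonoidHom 5 : (W.baseChange (w.adicCompletion ℚ)).toAffine.Point →+ _).ker ≤ 5 := by
  intro w hw
  haveI : Fact (Nat.Prime 41) := ⟨by norm_num⟩
  refine natCard_ker_nsmul_five_adicCompletion_le_five_of_checkAt 41 0 0 0 (-7543864020) (-252196404634784) (by decide +kernel)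
    (k := 1) (S := 2) (cert := [((6 : ℤ), 0, 1, 0), ((20 : ℤ), 0, 1, 0)]) (by decide +kernel) (by norm_num) W ?_ hw
  rw [hWeq]; ext <;> norm_num

end Summit.BirchSwinnertonDyer.Rank1Residual.Supersingular

end
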